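import Summits.HodgeConjecture.HodgeCM.Prior.Signatures_1

/-! PORT of `HodgeCM/Prior/Signatures.lean` (HodgeCMPerL run 82) — part 2: continuation of `Summits.HodgeConjecture.HodgeCM.Prior.Signatures_1` (split at a top-level declaration boundary by port_pkg.py; scope re-opened below; declarations unchanged). -/

-- port_pkg: scope re-opened for this part (file-level context, then the namespace/section stack open at the cut)
namespace HodgeCM.Prior.Signatures
namespace Perl34
variable {X : Type*} [DecidableEq X]
section signatures

variable {X : Type*} [DecidableEq X] {ι : X → X} {Ψ₁ Ψ₂ Ψ₃ Ψ₄ Ψ Ψ' : Finset X}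

/-- rem:tetra "equivalently" (PerL ll.212-213): the pair-sum identity is equivalent to
the per-place sign identity `m_b(Ψ₁)+m_b(Ψ₂) = m_b(Ψ₃)+m_b(Ψ₄)` at every
representative. -/
theorem pairSum_iff_sgnSum :
    PairSum Ψ₁ Ψ₂ Ψ₃ Ψ₄ ↔ ∀ ρ, sgn Ψ₁ ρ + sgn Ψ₂ ρ = sgn Ψ₃ ρ + sgn Ψ₄ ρ := by
  constructor
  · intro h ρ
    have := h ρ
    simp only [sgn_eq_one_sub_two_ind]
    omega
  · intro h x
    have := h x
    simp only [sgn_eq_one_sub_two_ind] at this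
    omega

/-- Sum-to-multiset for ±1 pairs: the finite combinatorics behind "same signature at
every real place" (plan A2 "pair-sum ⇒ multiset"). -/
lemma multiset_pair_of_pm_sum_eq {a b a' b' : ℤ} (ha : a = -1 ∨ a = 1)
    (hb : b = -1 ∨ b = 1) (ha' : a' = -1 ∨ a' = 1) (hb' : b' = -1 ∨ b' = 1)
    (hsum : a + b = a' + b') : ({a, b} : Multiset ℤ) = {a', b'} := by
  rcases ha with rfl | rfl <;> rcases hb with rfl | rfl <;>
    rcases ha' with rfl | rfl <;> rcases hb' with rfl | rfl <;>
    first
      | rfl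
      | (exact absurd hsum (by decide))
      | decide

/-- lem:allowed(b), per-place multiset identity:
`{m_b(Ψ₁), m_b(Ψ₂)} = {m_b(Ψ₃), m_b(Ψ₄)}` at every place (PerL ll.284-287). -/
theorem sgn_multiset_of_pairSum (h : PairSum Ψ₁ Ψ₂ Ψ₃ Ψ₄) (ρ : X) :
    ({sgn Ψ₁ ρ, sgn Ψ₂ ρ} : Multiset ℤ) = {sgn Ψ₃ ρ, sgn Ψ₄ ρ} :=
  multiset_pair_of_pm_sum_eq (sgn_eq_neg_one_or_one _ _) (sgn_eq_neg_one_or_one _ _)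
    (sgn_eq_neg_one_or_one _ _) (sgn_eq_neg_one_or_one _ _)
    (pairSum_iff_sgnSum.mp h ρ)

/-- Forced-sign transport: applying any sign dictionary `f` (e.g. `m⁻¹` of [Y1neg]
Lemma 3.2, giving the forced signs `s_b(W_i) = m⁻¹(m_b(Ψ_i))` of PerL lem:allowed(a)
l.283-284) preserves the per-place multiset identity: `W₁⊕W₂` and `W₃⊕W₄` have the
same signature at every real place (lem:allowed(b) ll.284-285). -/
theorem forced_sign_multiset_of_pairSum (h : PairSum Ψ₁ Ψ₂ Ψ₃ Ψ₄) (f : ℤ → ℤ) (ρ : X) :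
    ({f (sgn Ψ₁ ρ), f (sgn Ψ₂ ρ)} : Multiset ℤ) = {f (sgn Ψ₃ ρ), f (sgn Ψ₄ ρ)} := by
  have := congrArg (Multiset.map f) (sgn_multiset_of_pairSum h ρ)
  simpa using this

/-- `Σ` of a pair of types: the places where the signs differ (PerL l.286: `Σ₁₂`,
the set of `b ≠ ι₁` with `m_b(Ψ₁) ≠ m_b(Ψ₂)` — stated here on all representatives;
representative-independence is `mem_sigmaP_iota`). -/
def SigmaP (Ψ Ψ' : Finset X) : Set X := {ρ | sgn Ψ ρ ≠ sgn Ψ' ρ}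

/-- `D` of a pair of types: the places where the signs agree (PerL l.285: `D₁₂`). -/
def DP (Ψ Ψ' : Finset X) : Set X := {ρ | sgn Ψ ρ = sgn Ψ' ρ}

/-- Σ and D are unions of places: membership is representative-independent. -/
lemma mem_sigmaP_iota (hι : ∀ x, ι (ι x) = x) (hΨ : IsCMS ι Ψ) (hΨ' : IsCMS ι Ψ')
    {ρ : X} : ι ρ ∈ SigmaP Ψ Ψ' ↔ ρ ∈ SigmaP Ψ Ψ' := by
  simp only [SigmaP, Set.mem_setOf_eq, hΨ.sgn_iota hι, hΨ'.sgn_iota hι]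
  constructor <;> intro hne he <;> exact hne (by omega)

/-- (no docstring in the 2001 source) -/
lemma mem_DP_iota (hι : ∀ x, ι (ι x) = x) (hΨ : IsCMS ι Ψ) (hΨ' : IsCMS ι Ψ')
    {ρ : X} : ι ρ ∈ DP Ψ Ψ' ↔ ρ ∈ DP Ψ Ψ' := by
  simp only [DP, Set.mem_setOf_eq, hΨ.sgn_iota hι, hΨ'.sgn_iota hι]
  omega

/-- `Σ₁₂ = Σ₃₄` (PerL lem:allowed(b); plan A2). -/
theorem sigmaP_eq_of_pairSum (h : PairSum Ψ₁ Ψ₂ Ψ₃ Ψ₄) :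
    SigmaP Ψ₁ Ψ₂ = SigmaP Ψ₃ Ψ₄ := by
  ext ρ
  simp only [SigmaP, Set.mem_setOf_eq]
  have hs := pairSum_iff_sgnSum.mp h ρ
  rcases sgn_eq_neg_one_or_one Ψ₁ ρ with h1 | h1 <;>
    rcases sgn_eq_neg_one_or_one Ψ₂ ρ with h2 | h2 <;>
    rcases sgn_eq_neg_one_or_one Ψ₃ ρ with h3 | h3 <;>
    rcases sgn_eq_neg_one_or_one Ψ₄ ρ with h4 | h4 <;>
    (constructor <;> intro hne <;> intro he <;> exact hne (by omega))

/-- `D₁₂ = D₃₄` (PerL lem:allowed(b); plan A2). -/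
theorem DP_eq_of_pairSum (h : PairSum Ψ₁ Ψ₂ Ψ₃ Ψ₄) : DP Ψ₁ Ψ₂ = DP Ψ₃ Ψ₄ := by
  ext ρ
  simp only [DP, Set.mem_setOf_eq]
  have hs := pairSum_iff_sgnSum.mp h ρ
  rcases sgn_eq_neg_one_or_one Ψ₁ ρ with h1 | h1 <;>
    rcases sgn_eq_neg_one_or_one Ψ₂ ρ with h2 | h2 <;>
    rcases sgn_eq_neg_one_or_one Ψ₃ ρ with h3 | h3 <;>
    rcases sgn_eq_neg_one_or_one Ψ₄ ρ with h4 | h4 <;>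
    omega

/-- On `D₁₂` all four signs agree: both pairs are definite, with the same sign
(lem:allowed(b): "definite at the set D₁₂"). -/
theorem all_sgn_eq_on_DP (h : PairSum Ψ₁ Ψ₂ Ψ₃ Ψ₄) {ρ : X}
    (hd : sgn Ψ₁ ρ = sgn Ψ₂ ρ) :
    sgn Ψ₃ ρ = sgn Ψ₁ ρ ∧ sgn Ψ₄ ρ = sgn Ψ₁ ρ := by
  have hs := pairSum_iff_sgnSum.mp h ρ
  rcases sgn_eq_neg_one_or_one Ψ₁ ρ with h1 | h1 <;>
    rcases sgn_eq_neg_one_or_one Ψ₃ ρ with h3 | h3 <;>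
    rcases sgn_eq_neg_one_or_one Ψ₄ ρ with h4 | h4 <;>
    (constructor <;> omega)

/-- On `Σ₁₂` both sign sums vanish: both pairs are of signature (1,1)
(lem:allowed(b): "(1,1) at the non-empty set Σ₁₂"). -/
theorem sgn_sum_zero_on_sigmaP (h : PairSum Ψ₁ Ψ₂ Ψ₃ Ψ₄) {ρ : X}
    (hd : sgn Ψ₁ ρ ≠ sgn Ψ₂ ρ) :
    sgn Ψ₁ ρ + sgn Ψ₂ ρ = 0 ∧ sgn Ψ₃ ρ + sgn Ψ₄ ρ = 0 ∧ sgn Ψ₃ ρ ≠ sgn Ψ₄ ρ := by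
  have hs := pairSum_iff_sgnSum.mp h ρ
  rcases sgn_eq_neg_one_or_one Ψ₁ ρ with h1 | h1 <;>
    rcases sgn_eq_neg_one_or_one Ψ₂ ρ with h2 | h2 <;>
    rcases sgn_eq_neg_one_or_one Ψ₃ ρ with h3 | h3 <;>
    rcases sgn_eq_neg_one_or_one Ψ₄ ρ with h4 | h4 <;>
    refine ⟨by omega, by omega, fun he => ?_⟩ <;> omega

/-- `Σ₁₂ ≠ ∅`, away from the base place (PerL lem:allowed(b) l.297: "Σ₁₂ ≠ ∅ because
Ψ₁ ≠ Ψ₂ and both contain φ^h (so they differ at some b ≠ ι₁)"). -/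
theorem sigmaP_nonempty_off_base (hΨ₁ : IsCMS ι Ψ₁) (hΨ₂ : IsCMS ι Ψ₂) {φh : X}
    (h1 : φh ∈ Ψ₁) (h2 : φh ∈ Ψ₂) (hne : Ψ₁ ≠ Ψ₂) :
    ∃ ρ, ρ ≠ φh ∧ ρ ≠ ι φh ∧ ρ ∈ SigmaP Ψ₁ Ψ₂ := by
  obtain ⟨x, hx1, hx2, hc⟩ := hΨ₁.exists_differ_off_basepoint hΨ₂ h1 h2 hne
  refine ⟨x, hx1, hx2, ?_⟩
  simp only [SigmaP, Set.mem_setOf_eq]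
  rcases hc with ⟨hm, hm'⟩ | ⟨hm, hm'⟩
  · rw [sgn_of_mem hm, sgn_of_not_mem hm']
    omega
  · rw [sgn_of_not_mem hm, sgn_of_mem hm']
    omega

/-- At the base place all four types carry the same sign `-1` ("one sign per place" at
`ι₁`, the combinatorial shadow of lem:allowed(b)'s `ι₁` clause: all four contain φ^h). -/
theorem sgn_basepoint_all {φh : X} (m1 : φh ∈ Ψ₁) (m2 : φh ∈ Ψ₂) (m3 : φh ∈ Ψ₃)
    (m4 : φh ∈ Ψ₄) :
    sgn Ψ₁ φh = -1 ∧ sgn Ψ₂ φh = -1 ∧ sgn Ψ₃ φh = -1 ∧ sgn Ψ₄ φh = -1 :=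
  ⟨sgn_of_mem m1, sgn_of_mem m2, sgn_of_mem m3, sgn_of_mem m4⟩

end signatures

/-! ## Smoke tests on the g = 3 tetrahedron (PerL l.60)
Sign-vector model inlined from S1/A1_Faces.lean (marked region). -/

section smoke

-- ===== BEGIN [A1_Faces.lean sign-vector model verbatim] =====
/-- Embeddings of a CM field over a totally real field with `g` real places:
`(a, s)`, the two embeddings above place `a`. -/
abbrev Emb (g : ℕ) := Fin g × Bool

/-- Complex conjugation on embeddings. -/
def svIota (g : ℕ) : Emb g → Emb g := fun p => (p.1, !p.2)

/-- The CM type of a sign vector `t : Fin g → Bool` (`t a = true` iff the type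
contains the embedding `(a, true)`; PerL ll.56-60, rfwf l.91 "writing types as sign
vectors"). -/
def svType {g : ℕ} (t : Fin g → Bool) : Finset (Emb g) :=
  Finset.univ.filter (fun p => t p.1 = p.2)

/-- The tetrahedron of CM types (PerL l.60): `t¹=(+,+,+)`, `t²=(+,−,−)`, `t³=(+,−,+)`,
`t⁴=(+,+,−)`, with `true` = `+`. -/
def tet1 : Fin 3 → Bool := ![true, true, true]
/-- (no docstring in the 2001 source) -/
def tet2 : Fin 3 → Bool := ![true, false, false]
/-- (no docstring in the 2001 source) -/
def tet3 : Fin 3 → Bool := ![true, false, true]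
/-- (no docstring in the 2001 source) -/
def tet4 : Fin 3 → Bool := ![true, true, false]
-- ===== END [A1_Faces.lean sign-vector model verbatim] =====

/-- Smoke: Σ₁₂ = Σ₃₄ pointwise on the tetrahedron, decided. -/
example : ∀ p : Emb 3, (sgn (svType tet1) p ≠ sgn (svType tet2) p)
    ↔ (sgn (svType tet3) p ≠ sgn (svType tet4) p) := by decide

/-- Smoke: the per-place multiset identity on the tetrahedron, decided. -/
example : ∀ p : Emb 3, ({sgn (svType tet1) p, sgn (svType tet2) p} : Multiset ℤ)
    = {sgn (svType tet3) p, sgn (svType tet4) p} := by decide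

/-- Smoke: Σ₁₂ of the tetrahedron is non-empty away from the base place: the
representative `(1, +)` lies in it. -/
example : sgn (svType tet1) ((1 : Fin 3), true) ≠ sgn (svType tet2) ((1 : Fin 3), true)
    ∧ ((1 : Fin 3), true) ≠ ((0 : Fin 3), true) := by decide

end smoke

end Perl34



end HodgeCM.Prior.Signatures
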